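import Literature.AnabelianGeometry.SemiGraphs.HomToGroupCoverings
import Literature.AnabelianGeometry.SemiGraphs.TemperedEdgeLikeCentralizerOfCoveringSeparated
import Literature.AnabelianGeometry.SemiGraphs.TemperoidsHomTorsor
import HarnessLib

/-!
# (R3c) `EdgeLikeCentralizerAt` for graphs of anabelioids carrying a compatible family of homomorphisms to ONE
# profinite group, separated in that group ([SemiAnbd] Cor. 3.9 p. 43 l. 13; Thm. 3.7 (iii) p. 41; Rmk. 3.1.1–3.1.2 p. 33)

Mochizuki, *Semi-graphs of anabelioids*, Publ. RIMS **42** (2006), §3: Cor. 3.9 p. 43 l. 13 ("[again by Theorem 3.7,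
(iii), (iv)]" — step (R3c) `EdgeLikeCentralizerAt` of abc-iut-L3-d4's `TemperedReconstructionR3Sub`), Thm. 3.7 (iii)
p. 41 (edge-like subgroups), Rmk. 3.1.1 p. 33 ("every profinite group is tempered"), Rmk. 3.1.2 p. 33 (the Galois
objects `Π/N`) [cite: MochizukiSemiAnbd2006, Cor 3.9 p.43] [cite: MochizukiSemiAnbd2006, Thm 3.7(iii) p.41].

PROOF-ONLY file (abc-iut cell, layer L3 [SemiAnbd], block-F seat abc-iut-f-169 gen 4; FACT-LIST row **F-2772**
`ProfiniteSemiGraph.EdgeLikeCentralizerAt`, L3-lead row «F2772-INSTANCE@HOSTABLE-CORE» δ56 (2), SHAPES 6bbfce0e227dee9a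
FILE 3; 0 `def` · 0 `instance` · 0 notation · 0 `Prop` fact · 0 `sorry`).  Sequel of
`TemperedEdgeLikeCentralizerOfCoveringSeparated` (p523783: hostable ⇒ deck-equivariant transport of fibres in EVERY
tempered covering) and `HomToGroupCoverings` (the coverings `Φ^*(Y)` of `ℋ` pulled back from `G`-sets along a compatible
family `Φ : HomToGroup ℋ G` — abc-iut-f-176 gen 6's «kill the graph» retraction, memo FINDING-hostable-types-residual §3,
in covering currency).

## What is proved

* §1 the level-`N` coverings `Φ^*(G/N)` (`BTemp.Q`): edge actions `γ · zN = Φ_e(γ) z N`; the DECK TRANSFORMATIONS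
  `Φ^*(r_g)` induced by right translation (`BTemp.rightMul`) act on every fibre by `zN ↦ zgN`;
* §2 `exists_forall_eq_mul_of_forall_mul_right` — a self-map of `G/N` commuting with all right translations is a LEFT
  translation;
* §3 `exists_conj_map_le_sup_of_transport` — **the level-`N` test**: a deck-equivariant bijection between the `e`- and
  `e′`-fibres of `Φ^*(G/N)` carrying the action of `U ≤ Π_e` into the `Π_{e′}`-action forces
  `h · Φ_e(U) · h⁻¹ ≤ Φ_{e′}(Π_{e′}) · N` for some `h ∈ G` (via `conj_mem_sup_of_coe_eq`);
* §4 ★ `edgeLikeCentralizerAt_of_levelSeparated` — **the CLASS CLOSER**: `Cor39Hypotheses ℋ`, `G` compact tempered,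
  `Φ : HomToGroup ℋ G`, and for every edge `e`, open `U ≤ Π_e` and all but finitely many `e′` SOME open normal `N ⊴ G`
  with NO conjugate of `Φ_e(U)` inside `Φ_{e′}(Π_{e′}) · N` ⟹ `EdgeLikeCentralizerAt ℋ c` at EVERY chart `c`
  (feed `Φ^*(G/N)` to `edgeLikeCentralizerAt_of_coveringSeparated`); `…_of_profinite` (Rmk. 3.1.1
  `IsTempered.of_profinite`);
* §5 the COMPACTNESS UPGRADE for profinite `G` (`exists_openNormal_not_mem_sup`,
  `exists_openNormal_forall_not_conj_le`: no conjugate of `C` inside the CLOSED subgroup `A` ⇒ already at ONE finite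
  level no conjugate of `C` inside `A · N`) and ★ `edgeLikeCentralizerAt_of_separatedIn` — the closer with the displayed
  hypothesis in its natural form «NO conjugate `h·Φ_e(U)·h⁻¹` lies in `Φ_{e′}(Π_{e′})`» (for CONSTANT gluing data, i.e.
  bijective `Φ_v`: the branch family is conjugately separated in `G` — memo §3's "pairwise conjugately disjoint and
  malnormal" identical-end dipoles / `K_{ℵ₀}` / `ℵ₀`-regular trees with constant data);
* the F-2773-restricted ∀-form `edgeLikeCentralizer_of_levelSeparated`, hypothesis-free.

Binder census: structural data (chart, edges, `U`, `Φ`, `N`) + `Cor39Hypotheses ℋ` (the Corollary's own hypotheses) +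
the displayed separation hypothesis; FACT 0 · GAP 0 · smuggled 0.  HONEST LABEL: a CLASS theorem at OUR typing — the
first (R3c) class cut out by GLUING DATA rather than by graph shape or edge-group type; its content is the
infinite-valence / hostable-core regime (finite, locally finite, no-hostable-core graphs are abc-iut-f-176's classes);
whether a given Cor-3.9 graph with a core carries a separated `Φ` (e.g. a constant-data free-pro-`p`-product dipole
satisfying (H4)–(H6)) is the CARRIER question of a later row — no such object is in the tree, and nothing here claims
one.  F-2772's bare ∀-closure stays refuted-as-typed (abc-iut-f-140, p512532).  typed ≠ proved; class-proved at OUR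
typing ≠ print's ∀-claim; no side is taken on [IUTchIII] Cor. 3.12; nothing here asserts that abc is proved or refuted.
-/

namespace Literature.AnabelianGeometry.SemiGraphs

namespace ProfiniteSemiGraph

open CategoryTheory Topology

universe u


namespace HomToGroup

open Literature.AlgebraicGeometry.Frobenioids.QuasiTemperoid.BTempConnected (ρ_mul_apply)
open scoped Pointwise

variable {ℋ : ProfiniteSemiGraph.{u}} {G : Type u} [Group G] [TopologicalSpace G] [IsTopologicalGroup G]
  (hG : IsTempered G) (Φ : HomToGroup ℋ G)

/-! ### 1. The level-`N` covering `Φ^*(G/N)` and its deck transformations by right translation -/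

/-- The edge fibre action of `Φ^*(G/N)`: `γ · zN = Φ_e(γ) z N`. [cite: MochizukiSemiAnbd2006, §3 p.36] -/
theorem pullback_Q_ρE_apply (N : OpenNormalSubgroup G) (e : ℋ.graph.Edge) (γ : ℋ.Ge e) (z : G) :
    ((Φ.pullback.obj (BTemp.Q hG N)).SE e).obj.ρ γ (z : G ⧸ N.toSubgroup) =
      ((Φ.fe e γ * z : G) : G ⧸ N.toSubgroup) := by
  rw [pullback_ρE_apply, BTemp.Q_ρ_apply]

/-- The deck transformation of `Φ^*(G/N)` induced by right translation by `g` acts on every edge fibre by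
`zN ↦ zgN`. [cite: MochizukiSemiAnbd2006, Rmk 3.1.2 p.33] -/
theorem pullback_rightMul_fE_apply (N : OpenNormalSubgroup G) (g : G) (e : ℋ.graph.Edge) (q : G ⧸ N.toSubgroup) :
    ((Φ.pullback.map (BTemp.rightMul hG N g)).fE e).hom.hom q = q * (g : G ⧸ N.toSubgroup) := by
  rw [pullback_map_fE_apply, BTemp.rightMul_apply']

/-! ### 2. Bijections of `G/N` commuting with right translations are left translations -/

omit [TopologicalSpace G] [IsTopologicalGroup G] in
/-- A self-map of `G/N` commuting with all right translations is LEFT translation by (a lift of) its value at `1`.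
[cite: MochizukiSemiAnbd2006, Rmk 3.1.2 p.33] -/
theorem exists_forall_eq_mul_of_forall_mul_right (N : Subgroup G) [N.Normal] (f : G ⧸ N → G ⧸ N)
    (hf : ∀ g z : G, f ((z * g : G) : G ⧸ N) = f (z : G ⧸ N) * (g : G ⧸ N)) :
    ∃ h : G, ∀ z : G, f (z : G ⧸ N) = ((h * z : G) : G ⧸ N) := by
  obtain ⟨h, hh⟩ := QuotientGroup.mk_surjective (f ((1 : G) : G ⧸ N))
  refine ⟨h, fun z => ?_⟩
  have := hf z 1
  rw [one_mul] at this
  rw [this, ← hh, QuotientGroup.mk_mul]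

/-! ### 3. What a deck-equivariant transport of the `U`-action into the `Π_{e′}`-action says IN `G` -/

omit [TopologicalSpace G] [IsTopologicalGroup G] in
/-- Coset identity ⇒ membership in `A · N`: if `h·a ≡ r·h (mod N)` then `h a h⁻¹ ∈ ⟨r⟩' · N`, here with `r` ranging
over a subgroup `A`. [cite: MochizukiSemiAnbd2006, Thm 3.7(iii) p.41] -/
theorem conj_mem_sup_of_coe_eq (N : Subgroup G) [N.Normal] {A : Subgroup G} {h a r : G} (hr : r ∈ A)
    (heq : ((h * a : G) : G ⧸ N) = ((r * h : G) : G ⧸ N)) : h * a * h⁻¹ ∈ A ⊔ N := by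
  rw [QuotientGroup.eq] at heq
  -- `(h a)⁻¹ (r h) = n ∈ N`, so `h a h⁻¹ = r · (h n⁻¹ h⁻¹)`
  have hmem : h * a * h⁻¹ ∈ ((A : Set G) * (N : Set G)) := by
    refine Set.mem_mul.mpr ⟨r, hr, h * ((h * a)⁻¹ * (r * h))⁻¹ * h⁻¹, ?_, ?_⟩
    · exact Subgroup.Normal.conj_mem inferInstance _ (N.inv_mem heq) h
    · group
  rwa [← Subgroup.mul_normal] at hmem

/-- **The level-`N` test.**  Let `S = Φ^*(G/N)`.  If a bijection `f : S_e ≃ S_{e′}` (both fibres are `G/N`) commutes with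
the deck transformations by right translation and carries the action of every `u ∈ U ≤ Π_e` to the action of some
`γ ∈ Π_{e′}`, then for some `h ∈ G`: `h · Φ_e(U) · h⁻¹ ≤ Φ_{e′}(Π_{e′}) · N`.
[cite: MochizukiSemiAnbd2006, Thm 3.7(iii) p.41] -/
theorem exists_conj_map_le_sup_of_transport (h36 : ℋ.Prop36Hypotheses) (N : OpenNormalSubgroup G)
    [Finite (BTemp.Q hG N).obj.V] {e e' : ℋ.graph.Edge} {U : Subgroup (ℋ.Ge e)}
    (f : ((Φ.pullbackTemp h36 (BTemp.Q hG N)).obj.SE e).obj.V ≃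
      ((Φ.pullbackTemp h36 (BTemp.Q hG N)).obj.SE e').obj.V)
    (hfδ : ∀ g : G, ∀ s, f (((Φ.pullbackTempMap h36 (BTemp.rightMul hG N g)).hom.fE e).hom.hom s) =
      ((Φ.pullbackTempMap h36 (BTemp.rightMul hG N g)).hom.fE e').hom.hom (f s))
    (hfρ : ∀ u ∈ U, ∃ γ : ℋ.Ge e', ∀ s,
      f (((Φ.pullbackTemp h36 (BTemp.Q hG N)).obj.SE e).obj.ρ u s) =
        ((Φ.pullbackTemp h36 (BTemp.Q hG N)).obj.SE e').obj.ρ γ (f s)) :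
    ∃ h : G, ((U.map (Φ.fe e).toMonoidHom).map (MulAut.conj h).toMonoidHom : Subgroup G) ≤
      (Φ.fe e').toMonoidHom.range ⊔ N.toSubgroup := by
  -- `f` is a self-map of `G/N` commuting with right translations, hence a left translation by some `h`
  obtain ⟨h, hh⟩ := exists_forall_eq_mul_of_forall_mul_right N.toSubgroup f (fun g z => by
    have := hfδ g (z : G ⧸ N.toSubgroup)
    erw [pullback_rightMul_fE_apply, pullback_rightMul_fE_apply] at this
    rw [QuotientGroup.mk_mul]
    exact this)
  refine ⟨h, ?_⟩
  rintro _ ⟨_, ⟨u, hu, rfl⟩, rfl⟩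
  obtain ⟨γ, hγ⟩ := hfρ u hu
  have key := hγ ((1 : G) : G ⧸ N.toSubgroup)
  erw [pullback_Q_ρE_apply, hh, hh, pullback_Q_ρE_apply] at key
  simp only [mul_one] at key
  rw [MulEquiv.coe_toMonoidHom, MulAut.conj_apply, ContinuousMonoidHom.coe_toMonoidHom]
  exact conj_mem_sup_of_coe_eq N.toSubgroup ⟨γ, rfl⟩ key



/-! ### 4. The CLASS CLOSER: (R3c) at every chart from separation at ONE finite level of `G` -/

/-- **(R3c) F-2772 `EdgeLikeCentralizerAt ℋ c` at EVERY chart of a Cor-3.9 graph of anabelioids carrying a compatible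
family `Φ : HomToGroup ℋ G` to a compact tempered group, whose far edges are SEPARATED from each open edge piece at
ONE finite level of `G`**: if for every edge `e`, every open `U ≤ Π_e` and all but finitely many `e′` there is an open
normal `N ⊴ G` such that NO conjugate `h·Φ_e(U)·h⁻¹` lies in `Φ_{e′}(Π_{e′})·N`, then the centraliser of every open
edge piece `ψ(U)` of `π₁^temp(H)` lies in each of its verticial hosts.  Proof: the covering `Φ^*(G/N)` separates
(§3) and abc-iut-f-169's covering-separation criterion `edgeLikeCentralizerAt_of_coveringSeparated` (p523783) applies.
CLASS theorem at OUR typing with displayed hypotheses {`Cor39Hypotheses`, `Φ`, level separation}; constant gluing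
data (abc-iut-f-176 gen 6 memo §3) is the case of bijective `Φ_v`.  [cite: MochizukiSemiAnbd2006, Cor 3.9 p.43] -/
theorem edgeLikeCentralizerAt_of_levelSeparated (hℋ : Cor39Hypotheses ℋ) (hG : IsTempered G) [CompactSpace G]
    (hsep : ∀ (e : ℋ.graph.Edge) (U : Subgroup (ℋ.Ge e)), IsOpen (U : Set (ℋ.Ge e)) →
      ∃ E₀ : Set ℋ.graph.Edge, E₀.Finite ∧ ∀ e' ∉ E₀, ∃ N : OpenNormalSubgroup G,
        ∀ h : G, ¬ ((U.map (Φ.fe e).toMonoidHom).map (MulAut.conj h).toMonoidHom ≤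
          (Φ.fe e').toMonoidHom.range ⊔ N.toSubgroup))
    (c : TemperedPiChart ℋ) : EdgeLikeCentralizerAt ℋ c := by
  refine edgeLikeCentralizerAt_of_coveringSeparated hℋ c fun e U hU => ?_
  obtain ⟨E₀, hE₀, hsep'⟩ := hsep e U hU
  refine ⟨E₀, hE₀, fun e' he' => ?_⟩
  obtain ⟨N, hN⟩ := hsep' e' he'
  haveI : Finite (BTemp.Q hG N).obj.V := inferInstanceAs (Finite (G ⧸ N.toSubgroup))
  refine ⟨Φ.pullbackTemp hℋ.toProp36Hypotheses (BTemp.Q hG N), fun f hfδ hfρ => ?_⟩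
  obtain ⟨h, hh⟩ := Φ.exists_conj_map_le_sup_of_transport hG hℋ.toProp36Hypotheses N f
    (fun g s => hfδ (Φ.pullbackTempMap _ (BTemp.rightMul hG N g)) s) hfρ
  exact hN h hh

/-- The same with `G` compact and totally disconnected (profinite groups are tempered, [SemiAnbd] Rmk. 3.1.1,
`IsTempered.of_profinite`). [cite: MochizukiSemiAnbd2006, Cor 3.9 p.43] -/
theorem edgeLikeCentralizerAt_of_levelSeparated_of_profinite (hℋ : Cor39Hypotheses ℋ) [CompactSpace G]
    [TotallyDisconnectedSpace G] (Φ : HomToGroup ℋ G)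
    (hsep : ∀ (e : ℋ.graph.Edge) (U : Subgroup (ℋ.Ge e)), IsOpen (U : Set (ℋ.Ge e)) →
      ∃ E₀ : Set ℋ.graph.Edge, E₀.Finite ∧ ∀ e' ∉ E₀, ∃ N : OpenNormalSubgroup G,
        ∀ h : G, ¬ ((U.map (Φ.fe e).toMonoidHom).map (MulAut.conj h).toMonoidHom ≤
          (Φ.fe e').toMonoidHom.range ⊔ N.toSubgroup))
    (c : TemperedPiChart ℋ) : EdgeLikeCentralizerAt ℋ c :=
  Φ.edgeLikeCentralizerAt_of_levelSeparated hℋ IsTempered.of_profinite hsep c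

/-! ### 5. Separation IN `G` ⇒ separation at one finite level (compactness of a profinite `G`) -/

section Profinite

variable [CompactSpace G] [TotallyDisconnectedSpace G]

omit hG Φ in
/-- In a profinite group, a point outside a CLOSED subgroup `A` stays outside `A · N` for some open normal `N`
(open normal subgroups form a basis of neighbourhoods of `1`). [cite: MochizukiSemiAnbd2006, Rmk 3.1.1 p.33] -/
theorem exists_openNormal_not_mem_sup {A : Subgroup G} (hA : IsClosed (A : Set G)) {x : G} (hx : x ∉ A) :
    ∃ N : OpenNormalSubgroup G, x ∉ A ⊔ N.toSubgroup := by
  have hU : IsOpen {g : G | x * g⁻¹ ∈ (A : Set G)ᶜ} := hA.isOpen_compl.preimage (by fun_prop)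
  have h1 : (1 : G) ∈ {g : G | x * g⁻¹ ∈ (A : Set G)ᶜ} := by simpa using hx
  obtain ⟨N, hN⟩ := ProfiniteGrp.exist_openNormalSubgroup_sub_open_nhds_of_one hU h1
  refine ⟨N, fun hmem => ?_⟩
  have hmem' : x ∈ ((A : Set G) * (N.toSubgroup : Set G)) := by
    rw [← Subgroup.mul_normal]; exact hmem
  obtain ⟨a, ha, n, hn, rfl⟩ := Set.mem_mul.mp hmem'
  have := hN hn
  simp only [Set.mem_setOf_eq, mul_inv_cancel_right, Set.mem_compl_iff, SetLike.mem_coe] at this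
  exact this ha

omit hG Φ in
/-- **Compactness upgrade.**  In a profinite group `G`, if NO conjugate of the subgroup `C` lies in the CLOSED subgroup
`A`, then already at ONE finite level no conjugate of `C` lies in `A · N` (`N ⊴ G` open normal): for each `h` pick
`c_h ∈ C` with `h c_h h⁻¹ ∉ A`, then `N_h` with `h c_h h⁻¹ ∉ A·N_h`; the conditions `h′ c_h h′⁻¹ ∉ A·N_h` are open in `h′`
and cover `G`; a finite subcover and `N := ⋂ N_{h_i}` do it. [cite: MochizukiSemiAnbd2006, Rmk 3.1.1 p.33] -/
theorem exists_openNormal_forall_not_conj_le {C A : Subgroup G} (hA : IsClosed (A : Set G))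
    (hsep : ∀ h : G, ¬ C.map (MulAut.conj h).toMonoidHom ≤ A) :
    ∃ N : OpenNormalSubgroup G, ∀ h : G, ¬ C.map (MulAut.conj h).toMonoidHom ≤ A ⊔ N.toSubgroup := by
  classical
  have hc : ∀ h : G, ∃ c ∈ C, h * c * h⁻¹ ∉ A := by
    intro h
    by_contra hcon
    push Not at hcon
    refine hsep h ?_
    rintro _ ⟨c, hcC, rfl⟩
    simpa using hcon c hcC
  choose c hcC hcA using hc
  choose N hN using fun h => exists_openNormal_not_mem_sup hA (hcA h)
  -- the open cover `W h := {h' | h' c_h h'⁻¹ ∉ A ⊔ N_h}`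
  let W : G → Set G := fun h => {h' : G | h' * c h * h'⁻¹ ∈ ((A ⊔ (N h).toSubgroup : Subgroup G) : Set G)ᶜ}
  have hWo : ∀ h, IsOpen (W h) := fun h => by
    have hop : IsOpen ((A ⊔ (N h).toSubgroup : Subgroup G) : Set G) :=
      Subgroup.isOpen_mono (le_sup_right : (N h).toSubgroup ≤ A ⊔ (N h).toSubgroup) (N h).isOpen'
    exact ((A ⊔ (N h).toSubgroup).isClosed_of_isOpen hop).isOpen_compl.preimage (by fun_prop)
  have hWcov : (Set.univ : Set G) ⊆ ⋃ h, W h := fun h _ => Set.mem_iUnion.mpr ⟨h, hN h⟩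
  obtain ⟨t, ht⟩ := isCompact_univ.elim_finite_subcover W hWo hWcov
  have htne : t.Nonempty := by
    by_contra hte
    rw [Finset.not_nonempty_iff_eq_empty] at hte
    subst hte
    simpa using ht (Set.mem_univ (1 : G))
  refine ⟨t.inf' htne N, fun h hle => ?_⟩
  obtain ⟨i, hit, hi⟩ : ∃ i ∈ t, h ∈ W i := by simpa using ht (Set.mem_univ h)
  apply hi
  have hNle : ((t.inf' htne N).toSubgroup : Subgroup G) ≤ (N i).toSubgroup := fun x hx =>
    (Finset.inf'_le N hit : t.inf' htne N ≤ N i) hx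
  exact (sup_le_sup_left hNle A) (hle ⟨c i, hcC i, rfl⟩)

omit [CompactSpace G] in
/-- The range of a continuous homomorphism from the (compact) edge group into a profinite group is closed.
[cite: MochizukiSemiAnbd2006, Rmk 3.1.1 p.33] -/
theorem isClosed_range_fe (e : ℋ.graph.Edge) : IsClosed ((Φ.fe e).toMonoidHom.range : Set G) := by
  have : ((Φ.fe e).toMonoidHom.range : Set G) = Set.range (Φ.fe e) := by
    ext x; simp
  rw [this]
  exact (isCompact_range (Φ.fe e).continuous).isClosed

/-- **(R3c) F-2772 `EdgeLikeCentralizerAt ℋ c` at EVERY chart of a Cor-3.9 graph carrying a compatible family `Φ` to a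
PROFINITE group, whose far edges are SEPARATED IN `G` from each open edge piece**: if for every edge `e`, every open
`U ≤ Π_e` and all but finitely many `e′` NO conjugate `h·Φ_e(U)·h⁻¹` lies in `Φ_{e′}(Π_{e′})` (for constant gluing data:
the branch family is conjugately separated in `G` — abc-iut-f-176 gen 6's memo §3, "pairwise conjugately disjoint and
malnormal"), then `EdgeLikeCentralizerAt ℋ c`.  (§5's compactness upgrade + §4.)  CLASS theorem at OUR typing with
displayed hypotheses {`Cor39Hypotheses`, `Φ`, separation in `G`}. [cite: MochizukiSemiAnbd2006, Cor 3.9 p.43] -/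
theorem edgeLikeCentralizerAt_of_separatedIn (hℋ : Cor39Hypotheses ℋ)
    (hsep : ∀ (e : ℋ.graph.Edge) (U : Subgroup (ℋ.Ge e)), IsOpen (U : Set (ℋ.Ge e)) →
      ∃ E₀ : Set ℋ.graph.Edge, E₀.Finite ∧ ∀ e' ∉ E₀,
        ∀ h : G, ¬ ((U.map (Φ.fe e).toMonoidHom).map (MulAut.conj h).toMonoidHom ≤
          (Φ.fe e').toMonoidHom.range))
    (c : TemperedPiChart ℋ) : EdgeLikeCentralizerAt ℋ c := by
  refine Φ.edgeLikeCentralizerAt_of_levelSeparated_of_profinite hℋ (fun e U hU => ?_) c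
  obtain ⟨E₀, hE₀, hsep'⟩ := hsep e U hU
  exact ⟨E₀, hE₀, fun e' he' => exists_openNormal_forall_not_conj_le (Φ.isClosed_range_fe e') (hsep' e' he')⟩

end Profinite

end HomToGroup

/-- **F-2773 `EdgeLikeCentralizer` RESTRICTED to Cor-3.9 graphs carrying a level-separated compatible family to a
profinite group, hypothesis-free.** (The bare ∀-fact F-2773 also ranges over graphs for which no such family exists —
abc-iut-f-176 gen 6's residual (R1)–(R2) — not treated here.) [cite: MochizukiSemiAnbd2006, Cor 3.9 p.43] -/
theorem edgeLikeCentralizer_of_levelSeparated :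
    ∀ (ℋ : ProfiniteSemiGraph.{u}), Cor39Hypotheses ℋ →
      ∀ (G : Type u) [Group G] [TopologicalSpace G] [IsTopologicalGroup G] [CompactSpace G]
        [TotallyDisconnectedSpace G] (Φ : HomToGroup ℋ G),
      (∀ (e : ℋ.graph.Edge) (U : Subgroup (ℋ.Ge e)), IsOpen (U : Set (ℋ.Ge e)) →
        ∃ E₀ : Set ℋ.graph.Edge, E₀.Finite ∧ ∀ e' ∉ E₀, ∃ N : OpenNormalSubgroup G,
          ∀ h : G, ¬ ((U.map (Φ.fe e).toMonoidHom).map (MulAut.conj h).toMonoidHom ≤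
            (Φ.fe e').toMonoidHom.range ⊔ N.toSubgroup)) →
      ∀ (c : TemperedPiChart ℋ), EdgeLikeCentralizerAt ℋ c :=
  fun _ hℋ _ _ _ _ _ _ Φ hsep c => Φ.edgeLikeCentralizerAt_of_levelSeparated_of_profinite hℋ hsep c

end ProfiniteSemiGraph

end Literature.AnabelianGeometry.SemiGraphs
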